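import Summits.BirchSwinnertonDyer.BirchSwinnertonDyer.Theorems.ByReductionTypeAtTwoRankOneAtTwoBigImageOddLocalOneDoorSubsliceNegDiscConverse
import Summits.BirchSwinnertonDyer.BirchSwinnertonDyer.Theorems.GenusKolyvaginAtTwoGenusPrimitiveSupplyAtTwoTwinSupplyPrint
import Summits.BirchSwinnertonDyer.BirchSwinnertonDyer.Theses.TwoAdicConverse
import Literature.NumberTheory.EllipticCurves.SelmerTrivialCorankProofs
import Literature.NumberTheory.EllipticCurves.SelmerTorsionTwistRestriction
import HarnessLib

/-!
# Route ByReductionTypeAtTwo, crux `RankOneAtTwoBigImageOddLocal` (stmt-BirchSwinnertonDyer-23715), LINE v8.15 `one_door_analytic`: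
# THE R⁻₀ SPLIT IS LOSSLESS MODULO THE RANK-`0` `2`-CONVERSE IN ITS TREE CURRENCY — `corank_{ℤ₂} Sel_{2^∞} = 0 ⟹ r_an = 0` for the twin
# (route TwoAdicConverse's cruxes BY NAME on the good-ordinary / multiplicative sub-class); `HasBottomRungDoorAtTwo W ↔ BSDp W 2` on the R⁻₀ class

Width prover seat `bsd-line-fkl-p2` g14 (2026-08-28), `--supports stmt-BirchSwinnertonDyer-23715` (helper).  THEOREMS ONLY (no definition, no named fact
introduced, no `sorry`).  Sequel of the lead's `Theorems/…OneDoorSubsliceNegDiscConverse.lean` (g15): there `BSDp W 2` gives R⁻₀'s non-divisibility at a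
`Sel₂`-trivial transposition-admissible prime door GIVEN the twin's two displayed inputs `L(W^{(d_K)},1) ≠ 0` and `BSDp Wd 2`
(`hasTwoDivisibilityUpToTorsion_zero_of_bsdp_two_at_transpDoor`), with the remark that these «are exactly the rank-`0` `2`-CONVERSE for the `Sel₂`-trivial
twist followed by rank-`0` `BSD₂`».  This file WIRES that remark to the tree's statements: the twin has `#Sel₂ = 1`, hence `corank_{ℤ₂} Sel_{2^∞}(Wd/ℚ) = 0`
(`selmerCorank_eq_zero_of_natCard_selmerGroup_eq_one_factFree`, BSZ Thm 5 (d)) — the HYPOTHESIS CURRENCY of route TwoAdicConverse's rank-`0` cruxes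
`GoodOrdinaryRankZeroTwoConverse` (item 19218) and `MultiplicativeRankZeroTwoConverse` (item 19219) — so a rank-`0` `2`-converse gives `r_an(Wd) = 0`,
whence `L(Wd,1) ≠ 0` (`analyticRank_eq_zero_iff`) and `BSDp Wd 2` from the route's four rank-`0` cruxes BY NAME (`bsdp_two_of_rankZero_cruxes`).
BSD is not proved by any of this; every statement is CONDITIONAL by design on PRINT named facts of the tree (Gross–Zagier `gross_zagier`, Kolyvagin
`kolyvagin`, modularity as a newform `exists_isNewformOf`, Hoffstein–Luo `HoffsteinLuo1997_exists_twist_L_one_ne_zero`, Gross 1991 Prop. 3.7 (2)), on the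
route's four rank-`0` cruxes BY NAME, and on a rank-`0` `2`-CONVERSE — either the reduction-type-free form `∀ V non-CM globally minimal,
corank_{ℤ₂} Sel_{2^∞}(V/ℚ) = 0 → r_an(V) = 0` (binder `hconv`; OPEN at `p = 2`, nothing asserted: BSTW 2024 Thm 4.3 / CGLS need `p` odd), or, for `W` good
ordinary or multiplicative at `2`, the two TwoAdicConverse cruxes BY NAME (the twin inherits the reduction type at `2`: `GenusKoly.goodOrd_or_mult_two_twin`).

* §1 `twin_selmerCorank_two_eq_zero_of_twistSelmerTwoCard_eq_one` (fact-free: `#Sel₂(W^{(d)}) = 1 ⟹ corank Sel_{2^∞}(Wd) = 0` on any model `Wd = Cd • W^{(d)}`);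
  `odd_of_doorAdmissible`; `twin_analyticRank_eq_zero_of_twoConverse_cruxes` (§5's engine: the twin's converse from the two cruxes BY NAME).
* §2 **`twist_ne_zero_and_exponent_zero_of_bsdp_two_of_twoConverse_at`** — THE CORE with the converse WIRED: at a `Sel₂`-trivial transposition-admissible
  prime door of a `Δ_W < 0`, `Ш(W)[2] = 0` curve of the slice's shape with `BSDp W 2`, given the twin's converse `¬CM → corank = 0 → r_an = 0` and
  `S_rankZeroTwin`: the door is OPEN (`L(W^{(d_K)},1) ≠ 0`) AND the Heegner point over an odd-constant datum has exponent `0` (the lead's theorem at the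
  derived `hLt`, `hBd`).
* §3 **R⁻₀ FROM `BSD₂` ON THE CLASS** (`heegnerNonDivisibilityAtSelmerTrivialPrimeDoorAtTwo_of_bsdTwo_on_class_of_twoConverse`) and **FROM THE CRUX**
  (`…_of_rankOneAtTwoBigImageOddLocal_of_twoConverse`); so v8.15 is LOSSLESS: `heegnerNonDiv_and_residuePlus_of_rankOneAtTwoBigImageOddLocal_of_twoConverse`
  (crux ⟹ R⁻₀ ∧ R₊, modulo PRINT⁴ + rank-`0` cruxes + `hconv`; with the lead's composition `rankOneAtTwoBigImageOddLocal_of_heegnerNonDivisibility_of_residuePlus`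
  this is crux ⟺ R⁻₀ ∧ R₊).
* §4 **THE CLASS IFF** `hasBottomRungDoorAtTwo_iff_bsdp_two_negDisc_of_twoConverse`: on {`Δ_W < 0`, `Ш(W)[2] = 0`, odd-constant datum}
  `HasBottomRungDoorAtTwo W ↔ BSDp W 2` (→ the sub-slice theorem; ← §2 at gk2-p4's UNCONDITIONAL supply `exists_transpAdmissible_door_twistSelmerTwoCard_eq_one`).
* §5 BY NAME on the good-ordinary-or-multiplicative-at-`2` sub-class: `hasTwoDivisibilityUpToTorsion_zero_of_bsdTwo_on_class_of_twoConverse_cruxes` and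
  `hasBottomRungDoorAtTwo_iff_bsdp_two_negDisc_of_twoConverse_cruxes` — every non-`BSD₂` input a tree statement by name (PRINT⁵, the four rank-`0` cruxes of
  this route, the two rank-`0` cruxes of route TwoAdicConverse).

References: [Zhang2014CJM] Thm. 1.1 (shape, p ≥ 5); [GrossZagier1986] Thm. I.6.3, V.§2; [GrossLMS1991] §10, Conj. 1.2; [Kolyvagin1990] Thm. A;
[MazurRubin2010] Prop. 3.3, Cor. 3.4 (i); [SilvermanAEC2009] Thm. X.4.2; [BhargavaSkinnerZhang2014] Thm. 5 (d); [BurungaleSkinnerTianWan2024] Thm. 4.3 (p odd);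
[AtkinLehner1970] §6.
-/

set_option autoImplicit false
-- the Theorems namespace of this sub repeats the summit name by design (D-0017 nested layout)
set_option linter.dupNamespace false

noncomputable section

open scoped Classical

namespace Summit.BirchSwinnertonDyer.BirchSwinnertonDyer.Theorems.RankOneAtTwoOneDoor

open WeierstrassCurve NumberField Literature.NumberTheory.EllipticCurves Literature.NumberTheory.EllipticCurves.ModularForms
  Summit.BirchSwinnertonDyer.Rank1Residual.F1Sign2
  Summit.BirchSwinnertonDyer.Rank1Residual.F1Sign2.TranspositionDoor
  Summit.BirchSwinnertonDyer.BirchSwinnertonDyer.Theses.ByReductionTypeAtTwo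
open Summit.BirchSwinnertonDyer.BirchSwinnertonDyer.Theses.TwoAdicConverse (GoodOrdinaryRankZeroTwoConverse MultiplicativeRankZeroTwoConverse)
open Summit.BirchSwinnertonDyer.BirchSwinnertonDyer.Theorems.GenusKolyTransp (exists_transpAdmissible_door_twistSelmerTwoCard_eq_one)
open Summit.BirchSwinnertonDyer.BirchSwinnertonDyer.Theorems.GenusKoly (goodOrd_or_mult_two_twin)

/-! ### §1 Currency: the twin's corank, the parity of the door, the twin's converse from the two cruxes -/

/-- **`#Sel₂(W^{(d)}) = 1 ⟹ corank_{ℤ₂} Sel_{2^∞}(Wd/ℚ) = 0` on any model `Wd = Cd • W^{(d)}`** — -desc's `twistSelmerTwoCard W d = 1` (read on the twist EQUATION)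
in the HYPOTHESIS CURRENCY of route TwoAdicConverse's rank-`0` cruxes (`W.selmerCorank 2 = 0`, read on a globally minimal model): `Sel` is attached to the curve,
not to an equation (`natCard_selmerGroup_eq_of_variableChange`), and a trivial `p`-Selmer group is a trivial `p^∞`-Selmer group (BSZ 2014 Thm 5 (d), first
sentence of its proof; tree `selmerCorank_eq_zero_of_natCard_selmerGroup_eq_one_factFree`).  Fact-free. [cite: BhargavaSkinnerZhang2014, Thm. 5 (d)]
[cite: SilvermanAEC2009, Thm. X.4.2] -/
theorem twin_selmerCorank_two_eq_zero_of_twistSelmerTwoCard_eq_one (W : WeierstrassCurve ℚ) {d : ℤ} (hsel : twistSelmerTwoCard W d = 1)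
    (Wd : WeierstrassCurve ℚ) [Wd.IsElliptic] (Cd : VariableChange ℚ) (hWd : Cd • W.quadraticTwist (d : ℚ) = Wd) : Wd.selmerCorank 2 = 0 := by
  have h1 : Nat.card (Wd.selmerGroup 2) = 1 := by
    unfold twistSelmerTwoCard at hsel
    rw [← natCard_selmerGroup_eq_of_variableChange 2 hWd]
    exact hsel
  exact selmerCorank_eq_zero_of_natCard_selmerGroup_eq_one_factFree Wd 2 h1

/-- `d ≡ 1 (mod 8)` (a door-admissible parameter) is odd. [folklore] -/
theorem odd_of_doorAdmissible (W : WeierstrassCurve ℚ) [W.IsGloballyMinimal] {d : ℤ} (hadm : DoorAdmissible W d) : Odd d := by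
  obtain ⟨-, -, hd8, -, -⟩ := hadm
  rw [Int.odd_iff]
  omega

/-- **The twin's rank-`0` `2`-converse FROM ROUTE TwoAdicConverse's CRUXES BY NAME**, for `W` good ordinary or multiplicative at `2`: `K` imaginary quadratic with ODD
`d_K` and the Heegner hypothesis for `N_W`, `Wd` a globally minimal model of the twist — then `Wd` is good ordinary or multiplicative at `2` like `W`
(`GenusKoly.goodOrd_or_mult_two_twin`: `N_{Wd} = N_W d_K²`, `a₂(Wd) = ±a₂(W)`; modularity only through the conductor of the twist), so `GoodOrdinaryRankZeroTwoConverse`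
(item 19218) resp. `MultiplicativeRankZeroTwoConverse` (item 19219) applies: `¬CM → corank_{ℤ₂} Sel_{2^∞}(Wd) = 0 → r_an(Wd) = 0`.  Both cruxes are OPEN at `p = 2`;
nothing is asserted. [cite: BurungaleSkinnerTianWan2024, Thm. 4.3 (p odd)] [cite: AtkinLehner1970, §6] -/
theorem twin_analyticRank_eq_zero_of_twoConverse_cruxes (hnf : exists_isNewformOf)
    (hOrd : GoodOrdinaryRankZeroTwoConverse) (hMult : MultiplicativeRankZeroTwoConverse)
    (W : WeierstrassCurve ℚ) [W.IsElliptic] [W.IsGloballyMinimal] [NeZero (W.conductorNorm ℤ)]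
    (hred : Rank1Residual.GoodOrd W 2 ∨ Rank1Residual.Mult W 2)
    (K : Type) [Field K] [NumberField K] (hK : IsImaginaryQuadratic K) (hdodd : Odd (NumberField.discr K))
    (hHN : SatisfiesHeegnerHypothesis (W.conductorNorm ℤ) K)
    (Wd : WeierstrassCurve ℚ) [Wd.IsElliptic] [Wd.IsGloballyMinimal] (Cd : VariableChange ℚ)
    (hWd : Cd • W.quadraticTwist (NumberField.discr K : ℚ) = Wd) (hCMd : ¬ Wd.HasCM) (hcork : Wd.selmerCorank 2 = 0) :
    Wd.analyticRank = 0 := by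
  rcases goodOrd_or_mult_two_twin hnf W K hK hdodd hHN Wd ⟨Cd, hWd⟩ hred with hO | hM
  · exact hOrd Wd hCMd hO hcork
  · exact hMult Wd hCMd hM hcork

/-! ### §2 The core with the converse wired: `BSD₂(W)` + the twin's `2`-converse open the door and force exponent `0` -/

/-- **`BSDp W 2` AT A `Sel₂`-TRIVIAL TRANSPOSITION-ADMISSIBLE PRIME DOOR, WITH THE TWIN'S RANK-`0` `2`-CONVERSE, OPENS THE DOOR AND FORCES KOLYVAGIN
NON-DIVISIBILITY.**  `W/ℚ` globally minimal, non-CM, odd torsion order, odd Tamagawa product, analytic rank `1`, `Δ_W < 0`, `Ш(W)[2] = 0`, **`BSDp W 2`**; `K` imaginary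
quadratic with `(d_K, q₀)` transposition-admissible and `#Sel₂(W^{(d_K)}) = 1`; `Dt` of level `N_W` with ODD constant, `H`, `ι`, `P ∈ E(K)` over the complex Heegner
point; `Wd` a globally minimal model of the twist with ITS converse `hconv : ¬CM → corank_{ℤ₂} Sel_{2^∞}(Wd) = 0 → r_an(Wd) = 0`, and rank-`0` `BSD₂` for non-CM
curves (`hZ : S_rankZeroTwin`); Gross–Zagier, Kolyvagin, modularity, Hoffstein–Luo as hypotheses.  THEN `L(W^{(d_K)},1) ≠ 0` AND `P ∉ 2E(K) + E(K)_tors`.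
Chain: `#Sel₂(Wd) = 1` ⟹ corank `0` (§1) ⟹ (`hconv`; `Wd` non-CM by `j`-invariance) `r_an(Wd) = 0` ⟹ `L(Wd,1) ≠ 0` (`analyticRank_eq_zero_iff`) `= L(W^{(d_K)},1)`
(`entireLFunction_smul`), and `BSDp Wd 2` (`hZ`); then the lead's `hasTwoDivisibilityUpToTorsion_zero_of_bsdp_two_at_transpDoor` (per-datum kernel iff left to
right: `2m + 1 = 0 + 0 + 1 + 0 + 0`).  CONDITIONAL by design; BSD is not proved by this. [cite: Zhang2014CJM, Thm. 1.1 (shape at p ≥ 5)]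
[cite: GrossZagier1986, Thm. I.6.3 and V.§2] [cite: BurungaleSkinnerTianWan2024, Thm. 4.3 (p odd)] [cite: BhargavaSkinnerZhang2014, Thm. 5 (d)] -/
theorem twist_ne_zero_and_exponent_zero_of_bsdp_two_of_twoConverse_at
    (hGZ : ∀ (N : ℕ) [NeZero N] (W : WeierstrassCurve ℚ) (K : Type) [Field K] [NumberField K], gross_zagier N W K)
    (hKo : ∀ (N : ℕ) [NeZero N] (W : WeierstrassCurve ℚ) (K : Type) [Field K] [NumberField K], kolyvagin N W K)
    (hnf : exists_isNewformOf) (hHL : HoffsteinLuo1997_exists_twist_L_one_ne_zero) (hZ : S_rankZeroTwin)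
    (W : WeierstrassCurve ℚ) [W.IsElliptic] [W.IsGloballyMinimal] [NeZero (W.conductorNorm ℤ)]
    (hCM : ¬ W.HasCM) (hT : Odd W.torsionOrder) (hc : Odd W.tamagawaProduct) (hr : W.analyticRank = 1)
    (hΔ : W.Δ < 0) (hSha : ShaTwoTrivial W) (hB : BSDp W 2)
    (K : Type) [Field K] [NumberField K] (hK : IsImaginaryQuadratic K) (q₀ : ℕ) [Fact q₀.Prime]
    (htr : TranspAdmissible W (NumberField.discr K) q₀) (hsel : twistSelmerTwoCard W (NumberField.discr K) = 1)
    (Dt : ModularParametrizationData W (W.conductorNorm ℤ)) (H : HeegnerDatum (W.conductorNorm ℤ) (NumberField.discr K)) (ι : K →+* ℂ)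
    (P : (W.baseChange K).toAffine.Point) (hP : WeierstrassCurve.Affine.Point.map ι.toRatAlgHom P = heegnerPointComplex Dt H) (hodd : Odd Dt.c)
    (Wd : WeierstrassCurve ℚ) [Wd.IsElliptic] [Wd.IsGloballyMinimal] (Cd : VariableChange ℚ)
    (hWd : Cd • W.quadraticTwist (NumberField.discr K : ℚ) = Wd) (hconv : ¬ Wd.HasCM → Wd.selmerCorank 2 = 0 → Wd.analyticRank = 0) :
    (W.quadraticTwist (NumberField.discr K : ℚ)).entireLFunction 1 ≠ 0 ∧ HasTwoDivisibilityUpToTorsion W K P 0 := by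
  have hmod : hasEntireLFunction_rat := hasEntireLFunction_rat_of_exists_isNewformOf hnf
  -- the twin: non-CM, corank `0`, hence (converse) analytic rank `0`: the door is open and `BSD₂(Wd)` holds
  have hD0 : (NumberField.discr K : ℚ) ≠ 0 := by exact_mod_cast NumberField.discr_ne_zero K
  haveI hEt : (W.quadraticTwist (NumberField.discr K : ℚ)).IsElliptic := W.isElliptic_quadraticTwist hD0
  have hCMd : ¬ Wd.HasCM := RamifiedPairUpperBound.not_hasCM_of_smul_quadraticTwist_eq hD0 hWd hCM
  have hrd : Wd.analyticRank = 0 := hconv hCMd (twin_selmerCorank_two_eq_zero_of_twistSelmerTwoCard_eq_one W hsel Wd Cd hWd)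
  have hLeq : Wd.entireLFunction = (W.quadraticTwist (NumberField.discr K : ℚ)).entireLFunction := by
    rw [← hWd, entireLFunction_smul]
  have hLt : (W.quadraticTwist (NumberField.discr K : ℚ)).entireLFunction 1 ≠ 0 := by
    rw [← hLeq]
    exact (Wd.analyticRank_eq_zero_iff_holds (hmod Wd)).1 hrd
  have hBd : BSDp Wd 2 := hZ Wd hCMd hrd
  exact ⟨hLt, hasTwoDivisibilityUpToTorsion_zero_of_bsdp_two_at_transpDoor hGZ hKo hnf hHL W hT hc hr hΔ hSha hB K hK q₀ htr hsel hLt Dt H ι P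
    hP hodd Wd Cd hWd hBd⟩

/-! ### §3 R⁻₀ from `BSD₂` on the class, and from the crux: v8.15 is lossless modulo the rank-`0` `2`-converse -/

/-- **R⁻₀ `HeegnerNonDivisibilityAtSelmerTrivialPrimeDoorAtTwo` FROM `BSD₂` ON THE CLASS**, modulo the four primary printed facts, the route's four rank-`0` cruxes
at `2` BY NAME (`bsdp_two_of_rankZero_cruxes` for the twin), and the reduction-type-free rank-`0` `2`-converse `hconv` (OPEN at `2`; nothing asserted): if every
curve of the slice with `Δ_W < 0`, `Ш(W)[2] = 0` and an odd-constant datum satisfies `BSDp W 2` (`hBcls`), then R⁻₀ holds — at every `Sel₂`-trivial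
transposition-admissible prime door of such a curve the Heegner point over an odd-constant datum is NOT `2`-divisible modulo torsion (§2 on a globally minimal
model of the twist, `hasGlobalMinimalModel_rat_holds`).  The converse of the lead's `bsdp_two_of_heegnerNonDivisibility_negDisc`: R⁻₀ is not a strengthening of
the crux on its class.  CONDITIONAL by design; BSD is not proved by this. [cite: Zhang2014CJM, Thm. 1.1] [cite: GrossZagier1986, Thm. I.6.3 and V.§2]
[cite: BurungaleSkinnerTianWan2024, Thm. 4.3 (p odd)] -/
theorem heegnerNonDivisibilityAtSelmerTrivialPrimeDoorAtTwo_of_bsdTwo_on_class_of_twoConverse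
    (hGZ : ∀ (N : ℕ) [NeZero N] (W : WeierstrassCurve ℚ) (K : Type) [Field K] [NumberField K], gross_zagier N W K)
    (hKo : ∀ (N : ℕ) [NeZero N] (W : WeierstrassCurve ℚ) (K : Type) [Field K] [NumberField K], kolyvagin N W K)
    (hnf : exists_isNewformOf) (hHL : HoffsteinLuo1997_exists_twist_L_one_ne_zero)
    (hZ4 : GoodOrdinaryRankZeroAtTwo ∧ MultiplicativeRankZeroAtTwo ∧ SupersingularRankZeroAtTwo ∧ AdditiveRankZeroAtTwo)
    (hconv : ∀ (V : WeierstrassCurve ℚ) [V.IsElliptic] [V.IsGloballyMinimal], ¬ V.HasCM → V.selmerCorank 2 = 0 → V.analyticRank = 0)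
    (hBcls : ∀ (W : WeierstrassCurve ℚ) [W.IsElliptic] [W.IsGloballyMinimal] [NeZero (W.conductorNorm ℤ)],
      ¬ W.HasCM → (∀ n : ℕ, W.HasSurjectiveModNGaloisRep ((2 ^ n : ℕ) : ℤ)) → Odd W.torsionOrder → Odd W.tamagawaProduct →
      W.analyticRank = 1 → W.Δ < 0 → ShaTwoTrivial W → (∃ Dt : ModularParametrizationData W (W.conductorNorm ℤ), Odd Dt.c) → BSDp W 2) :
    HeegnerNonDivisibilityAtSelmerTrivialPrimeDoorAtTwo := by
  intro W _ _ _ hCM hsurj hT hc hr hΔ hSha K _ _ hK q₀ _ htr _hnn _hcop _hHN hsel Dt H ι P hP hodd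
  have hB : BSDp W 2 := hBcls W hCM hsurj hT hc hr hΔ hSha ⟨Dt, hodd⟩
  have hD0 : (NumberField.discr K : ℚ) ≠ 0 := by exact_mod_cast NumberField.discr_ne_zero K
  haveI hEt : (W.quadraticTwist (NumberField.discr K : ℚ)).IsElliptic := W.isElliptic_quadraticTwist hD0
  obtain ⟨Cd, hCd⟩ := hasGlobalMinimalModel_rat_holds (W.quadraticTwist (NumberField.discr K : ℚ))
  haveI := hCd
  exact (twist_ne_zero_and_exponent_zero_of_bsdp_two_of_twoConverse_at hGZ hKo hnf hHL
    (fun V _ _ hVCM hV0 => bsdp_two_of_rankZero_cruxes hZ4 V hVCM hV0) W hCM hT hc hr hΔ hSha hB K hK q₀ htr hsel Dt H ι P hP hodd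
    (Cd • W.quadraticTwist (NumberField.discr K : ℚ)) Cd rfl (fun hVCM hV0 => hconv _ hVCM hV0)).2

/-- **R⁻₀ FROM THE CRUX** (modulo the four primary printed facts, the four rank-`0` cruxes BY NAME and the rank-`0` `2`-converse `hconv`): the crux
`RankOneAtTwoBigImageOddLocal` gives `BSDp W 2` on the whole slice, in particular on the R⁻₀ class.  CONDITIONAL by design; BSD is not proved by this.
[cite: Zhang2014CJM, Thm. 1.1] [cite: GrossLMS1991, Conj. 1.2 and §10] -/
theorem heegnerNonDivisibilityAtSelmerTrivialPrimeDoorAtTwo_of_rankOneAtTwoBigImageOddLocal_of_twoConverse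
    (hGZ : ∀ (N : ℕ) [NeZero N] (W : WeierstrassCurve ℚ) (K : Type) [Field K] [NumberField K], gross_zagier N W K)
    (hKo : ∀ (N : ℕ) [NeZero N] (W : WeierstrassCurve ℚ) (K : Type) [Field K] [NumberField K], kolyvagin N W K)
    (hnf : exists_isNewformOf) (hHL : HoffsteinLuo1997_exists_twist_L_one_ne_zero)
    (hZ4 : GoodOrdinaryRankZeroAtTwo ∧ MultiplicativeRankZeroAtTwo ∧ SupersingularRankZeroAtTwo ∧ AdditiveRankZeroAtTwo)
    (hconv : ∀ (V : WeierstrassCurve ℚ) [V.IsElliptic] [V.IsGloballyMinimal], ¬ V.HasCM → V.selmerCorank 2 = 0 → V.analyticRank = 0)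
    (hX : RankOneAtTwoBigImageOddLocal) : HeegnerNonDivisibilityAtSelmerTrivialPrimeDoorAtTwo :=
  heegnerNonDivisibilityAtSelmerTrivialPrimeDoorAtTwo_of_bsdTwo_on_class_of_twoConverse hGZ hKo hnf hHL hZ4 hconv
    (fun W _ _ _ hCM hsurj hT hc hr _ _ _ => hX W hCM hsurj hT hc hr)

/-- **v8.15 IS LOSSLESS modulo PRINT⁴ + rank-`0` cruxes + the rank-`0` `2`-converse: the crux gives BOTH registered residues R⁻₀ and R₊.**  R⁻₀ by the previous
theorem; R₊ through the lead's chain crux ⟹ hypothesis-free residue (`doorIndexLawFullCAtTwoSomeDoor_of_rankOneAtTwoBigImageOddLocal`) ⟹ residue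
(`doorIndexLawFullCAtTwoSomeDoorOffSubslice_of_someDoor`) ⟹ R₊ (`doorIndexLawFullCAtTwoSomeDoorResiduePlus_of_offSubslice`).  With the lead's v8.15 composition
`rankOneAtTwoBigImageOddLocal_of_heegnerNonDivisibility_of_residuePlus`: crux ⟺ R⁻₀ ∧ R₊ modulo those inputs.  CONDITIONAL by design; BSD is not proved by this.
[cite: GrossLMS1991, Conj. 1.2, §3 and §10] [cite: Zhang2014CJM, Thm. 1.1] -/
theorem heegnerNonDiv_and_residuePlus_of_rankOneAtTwoBigImageOddLocal_of_twoConverse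
    (hGZ : ∀ (N : ℕ) [NeZero N] (W : WeierstrassCurve ℚ) (K : Type) [Field K] [NumberField K], gross_zagier N W K)
    (hKo : ∀ (N : ℕ) [NeZero N] (W : WeierstrassCurve ℚ) (K : Type) [Field K] [NumberField K], kolyvagin N W K)
    (hnf : exists_isNewformOf) (hHL : HoffsteinLuo1997_exists_twist_L_one_ne_zero)
    (hZ4 : GoodOrdinaryRankZeroAtTwo ∧ MultiplicativeRankZeroAtTwo ∧ SupersingularRankZeroAtTwo ∧ AdditiveRankZeroAtTwo)
    (hconv : ∀ (V : WeierstrassCurve ℚ) [V.IsElliptic] [V.IsGloballyMinimal], ¬ V.HasCM → V.selmerCorank 2 = 0 → V.analyticRank = 0)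
    (hX : RankOneAtTwoBigImageOddLocal) :
    HeegnerNonDivisibilityAtSelmerTrivialPrimeDoorAtTwo ∧ DoorIndexLawFullCAtTwoSomeDoorResiduePlus :=
  ⟨heegnerNonDivisibilityAtSelmerTrivialPrimeDoorAtTwo_of_rankOneAtTwoBigImageOddLocal_of_twoConverse hGZ hKo hnf hHL hZ4 hconv hX,
    doorIndexLawFullCAtTwoSomeDoorResiduePlus_of_offSubslice (doorIndexLawFullCAtTwoSomeDoorOffSubslice_of_someDoor
      (doorIndexLawFullCAtTwoSomeDoor_of_rankOneAtTwoBigImageOddLocal hGZ hKo hnf hHL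
        (fun V _ _ hVCM hV0 => bsdp_two_of_rankZero_cruxes hZ4 V hVCM hV0) hX))⟩

/-! ### §4 The class iff: on {`Δ_W < 0`, `Ш(W)[2] = 0`, odd-constant datum}, `HasBottomRungDoorAtTwo W ↔ BSDp W 2` -/

/-- **`BSDp W 2 ⟹ W ADMITS A BOTTOM-RUNG DOOR DATUM`** on the class, modulo PRINT⁴ + rank-`0` cruxes + the rank-`0` `2`-converse: gk2-p4's UNCONDITIONAL supply
`GenusKolyTransp.exists_transpAdmissible_door_twistSelmerTwoCard_eq_one` gives a `Sel₂`-trivial transposition-admissible prime door (`rank E(ℚ) = 1` from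
Gross–Zagier + Kolyvagin + modularity + Hoffstein–Luo); over its `K` the given odd-constant datum has a `K`-rational Heegner point
(`heegnerPointComplex_mem_range_map_holds`); §2 opens the door and makes the exponent `0`; the door is minimal (`minimal_of_transpAdmissible`) and door-admissible
(`ANg16.doorAdmissible_of_transpAdmissible`); a globally minimal model of the twist exists.  The converse of the lead's `hasBottomRungDoorAtTwo_of_heegnerNonDivisibility`
with R⁻₀ replaced by `BSD₂(W)` + the twin's converse.  CONDITIONAL by design; BSD is not proved by this. [cite: Zhang2014CJM, Thm. 1.1]
[cite: MazurRubin2010, Prop. 3.3 and Cor. 3.4 (i)] [cite: GrossZagier1986, Thm. I.6.3 and V.§2] -/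
theorem hasBottomRungDoorAtTwo_of_bsdp_two_negDisc_of_twoConverse
    (hGZ : ∀ (N : ℕ) [NeZero N] (W : WeierstrassCurve ℚ) (K : Type) [Field K] [NumberField K], gross_zagier N W K)
    (hKo : ∀ (N : ℕ) [NeZero N] (W : WeierstrassCurve ℚ) (K : Type) [Field K] [NumberField K], kolyvagin N W K)
    (hnf : exists_isNewformOf) (hHL : HoffsteinLuo1997_exists_twist_L_one_ne_zero)
    (hZ4 : GoodOrdinaryRankZeroAtTwo ∧ MultiplicativeRankZeroAtTwo ∧ SupersingularRankZeroAtTwo ∧ AdditiveRankZeroAtTwo)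
    (hconv : ∀ (V : WeierstrassCurve ℚ) [V.IsElliptic] [V.IsGloballyMinimal], ¬ V.HasCM → V.selmerCorank 2 = 0 → V.analyticRank = 0)
    (W : WeierstrassCurve ℚ) [W.IsElliptic] [W.IsGloballyMinimal] [NeZero (W.conductorNorm ℤ)]
    (hCM : ¬ W.HasCM) (hT : Odd W.torsionOrder) (hc : Odd W.tamagawaProduct) (hr : W.analyticRank = 1) (hΔ : W.Δ < 0) (hSha : ShaTwoTrivial W)
    (hB : BSDp W 2) (Dt : ModularParametrizationData W (W.conductorNorm ℤ)) (hodd : Odd Dt.c) : HasBottomRungDoorAtTwo W := by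
  have hT2 : NoRationalTwoTorsion W := noRationalTwoTorsion_of_odd_torsionOrder W hT
  have hrQ : W.mordellWeilRank = 1 := (mordellWeilRank_eq_one_of_analyticRank_eq_one_of_isGloballyMinimal hGZ hKo hnf hHL W hr).1
  -- the supply: a transposition-admissible prime door with trivial twin `Sel₂` (unconditional)
  obtain ⟨K, iF, iN, q₀, iq, hK, htr, -, -, hHN, hsel⟩ := exists_transpAdmissible_door_twistSelmerTwoCard_eq_one W hΔ hT2 hrQ hSha
  have hadm : DoorAdmissible W (NumberField.discr K) := ANg16.doorAdmissible_of_transpAdmissible W htr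
  have hmin : transpCount W (NumberField.discr K) + 2 * identCount W (NumberField.discr K) = (if W.Δ < 0 then 1 else 0) :=
    minimal_of_transpAdmissible W htr hΔ
  -- the Heegner datum over `K` and the `K`-rational point over the complex Heegner point of the given datum
  obtain ⟨H, -⟩ :=
    nonempty_heegnerDatum_holds (W.conductorNorm ℤ) K hK (exists_dvd_sq_sub_discr_holds (W.conductorNorm ℤ) K hK hHN).choose_spec
  obtain ⟨ι⟩ : Nonempty (K →+* ℂ) := inferInstance
  obtain ⟨P, hP⟩ := heegnerPointComplex_mem_range_map_holds (W.conductorNorm ℤ) W K hK hHN Dt H ι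
  -- a globally minimal model of the twist; §2 there
  have hD0 : (NumberField.discr K : ℚ) ≠ 0 := by exact_mod_cast NumberField.discr_ne_zero K
  haveI hEt : (W.quadraticTwist (NumberField.discr K : ℚ)).IsElliptic := W.isElliptic_quadraticTwist hD0
  obtain ⟨Cd, hCd⟩ := hasGlobalMinimalModel_rat_holds (W.quadraticTwist (NumberField.discr K : ℚ))
  haveI := hCd
  obtain ⟨hLt, hm0⟩ := twist_ne_zero_and_exponent_zero_of_bsdp_two_of_twoConverse_at hGZ hKo hnf hHL
    (fun V _ _ hVCM hV0 => bsdp_two_of_rankZero_cruxes hZ4 V hVCM hV0) W hCM hT hc hr hΔ hSha hB K hK q₀ htr hsel Dt H ι P hP hodd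
    (Cd • W.quadraticTwist (NumberField.discr K : ℚ)) Cd rfl (fun hVCM hV0 => hconv _ hVCM hV0)
  unfold HasBottomRungDoorAtTwo
  exact ⟨K, iF, iN, hK, hadm, hLt, hmin, Dt, H, ι, P, Cd • W.quadraticTwist (NumberField.discr K : ℚ), inferInstance, hCd, Cd, hP, rfl,
    hodd, hm0⟩

/-- **THE CLASS IFF: on {`Δ_W < 0`, `Ш(W)[2] = 0`, an odd-constant datum} a curve of the slice ADMITS A BOTTOM-RUNG DOOR DATUM IFF `BSDp W 2`**, modulo the five
printed facts (Gross 1991 Prop. 3.7 (2) only for →), the route's four rank-`0` cruxes BY NAME, and the rank-`0` `2`-converse `hconv`.  (→) is the sub-slice theorem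
(`bsdp_two_of_hasLawfulDoorAtTwo_of_rankZero_cruxes ∘ hasLawfulDoorAtTwo_of_hasBottomRungDoorAtTwo_of_print`); (←) is the previous theorem.  So on this class the
lead's v8.14 case split `HasBottomRungDoorAtTwo W` IS the `2`-part of BSD, and R⁻₀ is its door-free restatement.  CONDITIONAL by design; BSD is not proved by this.
[cite: Zhang2014CJM, Thm. 1.1] [cite: GrossLMS1991, §10 and Prop. 3.7 (2)] [cite: Kolyvagin1990, Thm. A] [cite: BurungaleSkinnerTianWan2024, Thm. 4.3 (p odd)] -/
theorem hasBottomRungDoorAtTwo_iff_bsdp_two_negDisc_of_twoConverse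
    (hGZ : ∀ (N : ℕ) [NeZero N] (W : WeierstrassCurve ℚ) (K : Type) [Field K] [NumberField K], gross_zagier N W K)
    (hKo : ∀ (N : ℕ) [NeZero N] (W : WeierstrassCurve ℚ) (K : Type) [Field K] [NumberField K], kolyvagin N W K)
    (hnf : exists_isNewformOf) (hHL : HoffsteinLuo1997_exists_twist_L_one_ne_zero)
    (h37 : Literature.NumberTheory.EllipticCurves.GrossLMS1991.prop37_2_frobeniusCongruence)
    (hZ4 : GoodOrdinaryRankZeroAtTwo ∧ MultiplicativeRankZeroAtTwo ∧ SupersingularRankZeroAtTwo ∧ AdditiveRankZeroAtTwo)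
    (hconv : ∀ (V : WeierstrassCurve ℚ) [V.IsElliptic] [V.IsGloballyMinimal], ¬ V.HasCM → V.selmerCorank 2 = 0 → V.analyticRank = 0)
    (W : WeierstrassCurve ℚ) [W.IsElliptic] [W.IsGloballyMinimal] [NeZero (W.conductorNorm ℤ)]
    (hCM : ¬ W.HasCM) (hsurj : ∀ n : ℕ, W.HasSurjectiveModNGaloisRep ((2 ^ n : ℕ) : ℤ)) (hT : Odd W.torsionOrder)
    (hc : Odd W.tamagawaProduct) (hr : W.analyticRank = 1) (hΔ : W.Δ < 0) (hSha : ShaTwoTrivial W)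
    (hDt : ∃ Dt : ModularParametrizationData W (W.conductorNorm ℤ), Odd Dt.c) :
    HasBottomRungDoorAtTwo W ↔ BSDp W 2 := by
  refine ⟨fun hdoor => ?_, fun hB => ?_⟩
  · exact bsdp_two_of_hasLawfulDoorAtTwo_of_rankZero_cruxes hGZ hKo hnf hHL hZ4 W hCM hT hc hr
      (hasLawfulDoorAtTwo_of_hasBottomRungDoorAtTwo_of_print hGZ hKo hnf hHL h37 W hCM hsurj hT hc hr hdoor)
  · obtain ⟨Dt, hodd⟩ := hDt
    exact hasBottomRungDoorAtTwo_of_bsdp_two_negDisc_of_twoConverse hGZ hKo hnf hHL hZ4 hconv W hCM hT hc hr hΔ hSha hB Dt hodd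

/-! ### §5 By name for `W` good ordinary or multiplicative at `2`: route TwoAdicConverse's rank-`0` cruxes supply the twin's converse -/

/-- **R⁻₀'S CONCLUSION ON THE GOOD-ORDINARY-OR-MULTIPLICATIVE-AT-`2` SUB-CLASS FROM `BSD₂` ON THE CLASS, EVERY OTHER INPUT BY NAME**: the rank-`0` `2`-converse of §3
discharged from route TwoAdicConverse's cruxes `GoodOrdinaryRankZeroTwoConverse` / `MultiplicativeRankZeroTwoConverse` (§1), for the curves of the R⁻₀ class that
are good ordinary or multiplicative at `2`: at every `Sel₂`-trivial transposition-admissible prime door the Heegner point over an odd-constant datum is not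
`2`-divisible modulo torsion.  CONDITIONAL by design; BSD is not proved by this. [cite: Zhang2014CJM, Thm. 1.1] [cite: BurungaleSkinnerTianWan2024, Thm. 4.3 (p odd)]
[cite: GrossZagier1986, Thm. I.6.3 and V.§2] -/
theorem hasTwoDivisibilityUpToTorsion_zero_of_bsdTwo_on_class_of_twoConverse_cruxes
    (hGZ : ∀ (N : ℕ) [NeZero N] (W : WeierstrassCurve ℚ) (K : Type) [Field K] [NumberField K], gross_zagier N W K)
    (hKo : ∀ (N : ℕ) [NeZero N] (W : WeierstrassCurve ℚ) (K : Type) [Field K] [NumberField K], kolyvagin N W K)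
    (hnf : exists_isNewformOf) (hHL : HoffsteinLuo1997_exists_twist_L_one_ne_zero)
    (hZ4 : GoodOrdinaryRankZeroAtTwo ∧ MultiplicativeRankZeroAtTwo ∧ SupersingularRankZeroAtTwo ∧ AdditiveRankZeroAtTwo)
    (hOrd : GoodOrdinaryRankZeroTwoConverse) (hMult : MultiplicativeRankZeroTwoConverse)
    (hBcls : ∀ (W : WeierstrassCurve ℚ) [W.IsElliptic] [W.IsGloballyMinimal] [NeZero (W.conductorNorm ℤ)],
      ¬ W.HasCM → (∀ n : ℕ, W.HasSurjectiveModNGaloisRep ((2 ^ n : ℕ) : ℤ)) → Odd W.torsionOrder → Odd W.tamagawaProduct →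
      W.analyticRank = 1 → W.Δ < 0 → ShaTwoTrivial W → (∃ Dt : ModularParametrizationData W (W.conductorNorm ℤ), Odd Dt.c) → BSDp W 2)
    (W : WeierstrassCurve ℚ) [W.IsElliptic] [W.IsGloballyMinimal] [NeZero (W.conductorNorm ℤ)]
    (hCM : ¬ W.HasCM) (hsurj : ∀ n : ℕ, W.HasSurjectiveModNGaloisRep ((2 ^ n : ℕ) : ℤ)) (hT : Odd W.torsionOrder)
    (hc : Odd W.tamagawaProduct) (hr : W.analyticRank = 1) (hΔ : W.Δ < 0) (hSha : ShaTwoTrivial W)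
    (hred : Rank1Residual.GoodOrd W 2 ∨ Rank1Residual.Mult W 2)
    (K : Type) [Field K] [NumberField K] (hK : IsImaginaryQuadratic K) (q₀ : ℕ) [Fact q₀.Prime]
    (htr : TranspAdmissible W (NumberField.discr K) q₀) (hsel : twistSelmerTwoCard W (NumberField.discr K) = 1)
    (Dt : ModularParametrizationData W (W.conductorNorm ℤ)) (H : HeegnerDatum (W.conductorNorm ℤ) (NumberField.discr K)) (ι : K →+* ℂ)
    (P : (W.baseChange K).toAffine.Point) (hP : WeierstrassCurve.Affine.Point.map ι.toRatAlgHom P = heegnerPointComplex Dt H) (hodd : Odd Dt.c) :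
    HasTwoDivisibilityUpToTorsion W K P 0 := by
  have hB : BSDp W 2 := hBcls W hCM hsurj hT hc hr hΔ hSha ⟨Dt, hodd⟩
  have hadm : DoorAdmissible W (NumberField.discr K) := ANg16.doorAdmissible_of_transpAdmissible W htr
  have hHN : SatisfiesHeegnerHypothesis (W.conductorNorm ℤ) K := satisfiesHeegnerHypothesis_of_doorAdmissible W K hK hadm
  have hD0 : (NumberField.discr K : ℚ) ≠ 0 := by exact_mod_cast NumberField.discr_ne_zero K
  haveI hEt : (W.quadraticTwist (NumberField.discr K : ℚ)).IsElliptic := W.isElliptic_quadraticTwist hD0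
  obtain ⟨Cd, hCd⟩ := hasGlobalMinimalModel_rat_holds (W.quadraticTwist (NumberField.discr K : ℚ))
  haveI := hCd
  exact (twist_ne_zero_and_exponent_zero_of_bsdp_two_of_twoConverse_at hGZ hKo hnf hHL
    (fun V _ _ hVCM hV0 => bsdp_two_of_rankZero_cruxes hZ4 V hVCM hV0) W hCM hT hc hr hΔ hSha hB K hK q₀ htr hsel Dt H ι P hP hodd
    (Cd • W.quadraticTwist (NumberField.discr K : ℚ)) Cd rfl
    (fun hVCM hV0 => twin_analyticRank_eq_zero_of_twoConverse_cruxes hnf hOrd hMult W hred K hK (odd_of_doorAdmissible W hadm) hHN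
      (Cd • W.quadraticTwist (NumberField.discr K : ℚ)) Cd rfl hVCM hV0)).2

/-- **THE CLASS IFF BY NAME on the good-ordinary-or-multiplicative-at-`2` sub-class**: `HasBottomRungDoorAtTwo W ↔ BSDp W 2` for `W` of the slice with `Δ_W < 0`,
`Ш(W)[2] = 0`, an odd-constant datum, and good ordinary or multiplicative reduction at `2`, modulo the five printed facts, the route's four rank-`0` cruxes and route
TwoAdicConverse's `GoodOrdinaryRankZeroTwoConverse` / `MultiplicativeRankZeroTwoConverse` — every non-`BSD₂` input a tree statement BY NAME.  CONDITIONAL by design;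
BSD is not proved by this. [cite: Zhang2014CJM, Thm. 1.1] [cite: GrossLMS1991, §10 and Prop. 3.7 (2)] [cite: BurungaleSkinnerTianWan2024, Thm. 4.3 (p odd)] -/
theorem hasBottomRungDoorAtTwo_iff_bsdp_two_negDisc_of_twoConverse_cruxes
    (hGZ : ∀ (N : ℕ) [NeZero N] (W : WeierstrassCurve ℚ) (K : Type) [Field K] [NumberField K], gross_zagier N W K)
    (hKo : ∀ (N : ℕ) [NeZero N] (W : WeierstrassCurve ℚ) (K : Type) [Field K] [NumberField K], kolyvagin N W K)
    (hnf : exists_isNewformOf) (hHL : HoffsteinLuo1997_exists_twist_L_one_ne_zero)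
    (h37 : Literature.NumberTheory.EllipticCurves.GrossLMS1991.prop37_2_frobeniusCongruence)
    (hZ4 : GoodOrdinaryRankZeroAtTwo ∧ MultiplicativeRankZeroAtTwo ∧ SupersingularRankZeroAtTwo ∧ AdditiveRankZeroAtTwo)
    (hOrd : GoodOrdinaryRankZeroTwoConverse) (hMult : MultiplicativeRankZeroTwoConverse)
    (W : WeierstrassCurve ℚ) [W.IsElliptic] [W.IsGloballyMinimal] [NeZero (W.conductorNorm ℤ)]
    (hCM : ¬ W.HasCM) (hsurj : ∀ n : ℕ, W.HasSurjectiveModNGaloisRep ((2 ^ n : ℕ) : ℤ)) (hT : Odd W.torsionOrder)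
    (hc : Odd W.tamagawaProduct) (hr : W.analyticRank = 1) (hΔ : W.Δ < 0) (hSha : ShaTwoTrivial W)
    (hred : Rank1Residual.GoodOrd W 2 ∨ Rank1Residual.Mult W 2)
    (hDt : ∃ Dt : ModularParametrizationData W (W.conductorNorm ℤ), Odd Dt.c) :
    HasBottomRungDoorAtTwo W ↔ BSDp W 2 := by
  refine ⟨fun hdoor => ?_, fun hB => ?_⟩
  · exact bsdp_two_of_hasLawfulDoorAtTwo_of_rankZero_cruxes hGZ hKo hnf hHL hZ4 W hCM hT hc hr
      (hasLawfulDoorAtTwo_of_hasBottomRungDoorAtTwo_of_print hGZ hKo hnf hHL h37 W hCM hsurj hT hc hr hdoor)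
  · obtain ⟨Dt, hodd⟩ := hDt
    have hT2 : NoRationalTwoTorsion W := noRationalTwoTorsion_of_odd_torsionOrder W hT
    have hrQ : W.mordellWeilRank = 1 := (mordellWeilRank_eq_one_of_analyticRank_eq_one_of_isGloballyMinimal hGZ hKo hnf hHL W hr).1
    obtain ⟨K, iF, iN, q₀, iq, hK, htr, -, -, hHN, hsel⟩ := exists_transpAdmissible_door_twistSelmerTwoCard_eq_one W hΔ hT2 hrQ hSha
    have hadm : DoorAdmissible W (NumberField.discr K) := ANg16.doorAdmissible_of_transpAdmissible W htr
    have hmin : transpCount W (NumberField.discr K) + 2 * identCount W (NumberField.discr K) = (if W.Δ < 0 then 1 else 0) :=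
      minimal_of_transpAdmissible W htr hΔ
    obtain ⟨H, -⟩ :=
      nonempty_heegnerDatum_holds (W.conductorNorm ℤ) K hK (exists_dvd_sq_sub_discr_holds (W.conductorNorm ℤ) K hK hHN).choose_spec
    obtain ⟨ι⟩ : Nonempty (K →+* ℂ) := inferInstance
    obtain ⟨P, hP⟩ := heegnerPointComplex_mem_range_map_holds (W.conductorNorm ℤ) W K hK hHN Dt H ι
    have hD0 : (NumberField.discr K : ℚ) ≠ 0 := by exact_mod_cast NumberField.discr_ne_zero K
    haveI hEt : (W.quadraticTwist (NumberField.discr K : ℚ)).IsElliptic := W.isElliptic_quadraticTwist hD0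
    obtain ⟨Cd, hCd⟩ := hasGlobalMinimalModel_rat_holds (W.quadraticTwist (NumberField.discr K : ℚ))
    haveI := hCd
    obtain ⟨hLt, hm0⟩ := twist_ne_zero_and_exponent_zero_of_bsdp_two_of_twoConverse_at hGZ hKo hnf hHL
      (fun V _ _ hVCM hV0 => bsdp_two_of_rankZero_cruxes hZ4 V hVCM hV0) W hCM hT hc hr hΔ hSha hB K hK q₀ htr hsel Dt H ι P hP hodd
      (Cd • W.quadraticTwist (NumberField.discr K : ℚ)) Cd rfl
      (fun hVCM hV0 => twin_analyticRank_eq_zero_of_twoConverse_cruxes hnf hOrd hMult W hred K hK (odd_of_doorAdmissible W hadm) hHN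
        (Cd • W.quadraticTwist (NumberField.discr K : ℚ)) Cd rfl hVCM hV0)
    unfold HasBottomRungDoorAtTwo
    exact ⟨K, iF, iN, hK, hadm, hLt, hmin, Dt, H, ι, P, Cd • W.quadraticTwist (NumberField.discr K : ℚ), inferInstance, hCd, Cd, hP, rfl,
      hodd, hm0⟩

end Summit.BirchSwinnertonDyer.BirchSwinnertonDyer.Theorems.RankOneAtTwoOneDoor

end
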